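/-
Copyright (c) 2026 the pub-hodgecm-mathlib formalisation cell (harness21).  Prover seat hodgecm-mathlib-LH7-p02 (g6): LH4-plan (g7) LAYER C brick (C3d) (WORDs 16:03:57Z ∕ #37),
claim (R0) memo `F0/P3c/LH7/LH7-p02/g6/c3e0/CLAIM-R0-near-ell0.v1.LH7p02g6.md` ce7670c6d5446838 — the `X`-currency TRACE-FRAME twin of ★ `UnitaryThreeBorelCosetCountJZeroNear`
(F0P3b-p01 (g6)), near row AND equidistant sub-row (C3e-0); 2026-09-02.
-/
import Literature.NumberTheory.Automorphic.UnitaryThreeBorelCosetCountJZeroNear                 -- ★ the TAME count: `maximalIdeal_integer_eq_span` (CITED), frame (`flickerPH`, `flickerHK`, `ρ_m`, `natCard_subtype_comp_eq_mul`)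
import Literature.NumberTheory.Automorphic.UnitaryThreePHTowerRhoUnramified                     -- ★ C2-A p851992 (LH4-p01): the four `ρ_m` heads `…_of_unram` + ★ p851950 `exists_coe_eq_borel_of_mem_flickerPH'`
import Literature.NumberTheory.LocalFields.UnramifiedQuadraticNormResidueShiftPairsTraceX        -- ★ p852093 (this hand): the `X`-currency pair count `natCard_pairs_norm_congr_traceX` (= claim (R0)), any `ℓ ≥ 0`
import HarnessLib

/-!
# Flicker's Prop. 13, cases (c)∕(e) AND the equidistant row (`ℓ = 0`), AS A COSET COUNT — TRACE FRAME, `X`-currency, every residue characteristic: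
# `#{y ∈ P_H ⧸ (P_H ∩ H^K_m) : y⁻¹ τ₀ y ∈ H^K_m} = F · q^{m−1}(q+1) · (q^{(m−ℓ)−(j−2ℓ)}·q^{m−ℓ−1}(q+1))`, ANY `ℓ ≥ 0`

Topic `NumberTheory/Automorphic` (road «D-N7-inert», LAYER C, bricks (C3d′)∕(C3e-0)); namespace `Literature.NumberTheory.Automorphic.UnitaryGroup`.  THEOREMS ONLY: no definition, no named
fact, no instance, no notation, no `sorry`; kernel lane `--supports stmt-HodgeConjecture-24833`.  Cell `pub/hodgecm-mathlib` (D-0151), crux H413; dealer LH4-plan (g7) (WORD 16:38:57Z «then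
`…JZeroNearXTrace` over it»).  Twin of ★ `UnitaryThreeBorelCosetCountJZeroNear` for `UnramifiedLocalConjDatum σ ϖ` (+ `(2 : K) ≠ 0` as C2-A's characteristic token) whose criterion binder
is in the `X`-CURRENCY of the (C3b) trace normal form (★ p851968 FILE 1: `X = κν⁻¹ + w + r`, `C = r(s+r)`), `X = κ·(uσu)⁻¹ + x + ξ₀` with `x` the anti-fixed skew parameter of `p(u,x,w)`
and `ξ₀` ANY centre with `ξ₀ + σξ₀ = 2r + s` (the letter block `(hκ)(htr)…` is token-parallel to ★ p852089 `…JZeroHighTrace`, whose centre `κe + y₀` is one such `ξ₀`).  By claim (R0)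
(★ p852093 `isUnit_fixed_of_norm_sub_traceX`: `s` a UNIT ⇒ the range step holds at EVERY `ℓ`) the count needs NO `1 ≤ ℓ`: it serves the near row (c)∕(e) (`ℓ ≥ 1`) and the EQUIDISTANT
sub-row (C3e-0) (`ℓ = 0`, FINDING #19 downgraded: value VERBATIM) in ONE theorem.  HC_CM is proved only modulo the 7 printed citations (2 remaining named inputs: hLiu418 =
stmt-HodgeConjecture-24832, h413 = stmt-HodgeConjecture-24833) until rung 0 closes; count-neutral ((D-UNR) stays PRINT by D74′); this file pays no letter.

Route = ★'s: Step A (★ C2-A `ρ_m` heads `…_of_unram` + the `X`-shape dictionary §1) → Step B (★ `natCard_subtype_comp_eq_mul`) → Step C (★ C2-A surjectivity) → Step D = ★ p852093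
`natCard_pairs_norm_congr_traceX` DIRECTLY (no reindexing).  CONCLUSION = ★'s RHS VERBATIM.  ★ p852037 `…JZeroNearTrace` (frame currency, `1 ≤ ℓ`) stays as the alternative docking.

* §1 **`v_norm_sub_le_iff_factor_eq_xshape`** — `|N(κ(aσa)⁻¹ + x + c) − t| ≤ |ϖ^j| ↔ factor_j(X̄ σ̄X̄) = t̄` (PORT of ★ `v_norm_sub_le_iff_factor_eq`, `z ↦ κ(aσa)⁻¹ + x + c`).
* §2 **`natCard_cosets_of_iff_norm_sub_le_xshape`** — the coset count, any `ℓ` with `2ℓ < j ≤ m`.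

## References
* [Flicker1998UnitaryFL] Y. Z. Flicker, *Elementary proof of the fundamental lemma for a unitary group*, Canad. J. Math. 50 (1998), 74–98: Prop. 13 pp. 91–93, Prop. 8 p. 84.
* [Rogawski1990] J. D. Rogawski, *Automorphic Representations of Unitary Groups in Three Variables* (1990), §4.9 p. 55.
-/

set_option autoImplicit false

open scoped MatrixGroups WithZero Valued
open Matrix

namespace Literature.NumberTheory.Automorphic

namespace UnitaryGroup

open Literature.NumberTheory.Automorphic.HermitianLattice (unitaryInt mem_unitaryInt_iff UnramifiedLocalConjDatum)
open Literature.NumberTheory.LocalFields.UnramifiedQuadraticNorm IsLocalRing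

variable {K : Type*} [Field K] [Valued K ℤᵐ⁰] {ϖ : K} (σ : K →+* K) {J : Matrix (Fin 3) (Fin 3) K}

/-! ## §1 The dictionary for the norm condition in the `X`-currency -/

/-- **`|N(X) − t| ≤ |ϖ^j| ↔ factor_j(X̄ σ̄X̄) = t̄ (mod 𝓂^j)`** for `X = κ·(aσa)⁻¹ + x + c` (`|a| = 1`, `κ, x, c` integral, `t ∈ 𝒪`), where on classes modulo `𝓂^m`
`X̄ = κ̄·Ring.inverse (ā σ̄ā) + x̄ + c̄` — ★ `v_norm_sub_le_iff_factor_eq` with `z ↦ κ(aσa)⁻¹ + x + c`, unramified datum (only `hd.vσ`, `hd.vϖ` read). [cite: Flicker1998UnitaryFL, Prop. 13 p. 93] -/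
theorem v_norm_sub_le_iff_factor_eq_xshape (hd : UnramifiedLocalConjDatum σ ϖ) (hσO : ∀ y : 𝒪[K], (σ.comp 𝒪[K].subtype) y ∈ 𝒪[K])
    {j m : ℕ} (hjm : j ≤ m) {a κ x c t : K} (ha : Valued.v a = 1) (hκ : Valued.v κ ≤ 1) (hx : Valued.v x ≤ 1) (hc : Valued.v c ≤ 1) (ht : Valued.v t ≤ 1) :
    Valued.v ((κ * (a * σ a)⁻¹ + x + c) * σ (κ * (a * σ a)⁻¹ + x + c) - t) ≤ Valued.v (ϖ ^ j) ↔
      Ideal.Quotient.factor (Ideal.pow_le_pow_right hjm)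
        ((Ideal.Quotient.mk (𝓂[K] ^ m) ⟨κ, hκ⟩ * Ring.inverse (Ideal.Quotient.mk (𝓂[K] ^ m) ⟨a, ha.le⟩ *
              Ideal.quotientMap (𝓂[K] ^ m) ((σ.comp 𝒪[K].subtype).codRestrict 𝒪[K] hσO)
                (maximalIdeal_pow_le_comap_codRestrict σ hd.vϖ hd.vσ hσO m) (Ideal.Quotient.mk (𝓂[K] ^ m) ⟨a, ha.le⟩)) +
            Ideal.Quotient.mk (𝓂[K] ^ m) ⟨x, hx⟩ + Ideal.Quotient.mk (𝓂[K] ^ m) ⟨c, hc⟩) *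
          Ideal.quotientMap (𝓂[K] ^ m) ((σ.comp 𝒪[K].subtype).codRestrict 𝒪[K] hσO)
            (maximalIdeal_pow_le_comap_codRestrict σ hd.vϖ hd.vσ hσO m)
            (Ideal.Quotient.mk (𝓂[K] ^ m) ⟨κ, hκ⟩ * Ring.inverse (Ideal.Quotient.mk (𝓂[K] ^ m) ⟨a, ha.le⟩ *
                Ideal.quotientMap (𝓂[K] ^ m) ((σ.comp 𝒪[K].subtype).codRestrict 𝒪[K] hσO)
                  (maximalIdeal_pow_le_comap_codRestrict σ hd.vϖ hd.vσ hσO m) (Ideal.Quotient.mk (𝓂[K] ^ m) ⟨a, ha.le⟩)) +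
              Ideal.Quotient.mk (𝓂[K] ^ m) ⟨x, hx⟩ + Ideal.Quotient.mk (𝓂[K] ^ m) ⟨c, hc⟩)) =
        Ideal.Quotient.mk (𝓂[K] ^ j) ⟨t, ht⟩ := by
  have hσa : Valued.v (σ a) ≤ 1 := by rw [hd.vσ]; exact ha.le
  have hn1 : Valued.v (a * σ a) = 1 := by rw [map_mul, hd.vσ, ha, mul_one]
  have hn0 : a * σ a ≠ 0 := fun h => by rw [h, map_zero] at hn1; exact zero_ne_one hn1
  have hninv : Valued.v (a * σ a)⁻¹ ≤ 1 := by rw [map_inv₀, hn1, inv_one]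
  set σm := Ideal.quotientMap (𝓂[K] ^ m) ((σ.comp 𝒪[K].subtype).codRestrict 𝒪[K] hσO)
    (maximalIdeal_pow_le_comap_codRestrict σ hd.vϖ hd.vσ hσO m) with hσm
  have hσmk : ∀ (t : K) (ht : Valued.v t ≤ 1), σm (Ideal.Quotient.mk (𝓂[K] ^ m) ⟨t, ht⟩) =
      Ideal.Quotient.mk (𝓂[K] ^ m) ⟨σ t, by show Valued.v (σ t) ≤ 1; rw [hd.vσ]; exact ht⟩ := fun t ht => by
    rw [hσm, Ideal.quotientMap_mk]; rfl
  -- the inverse class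
  set nO : 𝒪[K] := ⟨a, ha.le⟩ * ⟨σ a, hσa⟩ with hnO
  set niO : 𝒪[K] := ⟨(a * σ a)⁻¹, hninv⟩ with hniO
  have hmul : Ideal.Quotient.mk (𝓂[K] ^ m) nO * Ideal.Quotient.mk (𝓂[K] ^ m) niO = 1 := by
    rw [← map_mul, ← map_one (Ideal.Quotient.mk (𝓂[K] ^ m))]
    congr 1
    apply Subtype.ext
    show (a * σ a) * (a * σ a)⁻¹ = 1
    exact mul_inv_cancel₀ hn0
  have hunit : IsUnit (Ideal.Quotient.mk (𝓂[K] ^ m) nO) := isUnit_iff_exists_inv.2 ⟨_, hmul⟩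
  have hinv : Ring.inverse (Ideal.Quotient.mk (𝓂[K] ^ m) ⟨a, ha.le⟩ * σm (Ideal.Quotient.mk (𝓂[K] ^ m) ⟨a, ha.le⟩)) =
      Ideal.Quotient.mk (𝓂[K] ^ m) niO := by
    rw [hσmk, ← map_mul, ← hnO, ← hunit.unit_spec, Ring.inverse_unit]
    exact Units.inv_eq_of_mul_eq_one_right (by rw [hunit.unit_spec]; exact hmul)
  -- the integral `X`
  set zO : 𝒪[K] := ⟨κ, hκ⟩ * niO + ⟨x, hx⟩ + ⟨c, hc⟩ with hzO
  have hzcoe : (zO : K) = κ * (a * σ a)⁻¹ + x + c := rfl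
  have hZ : Ideal.Quotient.mk (𝓂[K] ^ m) ⟨κ, hκ⟩ * Ring.inverse (Ideal.Quotient.mk (𝓂[K] ^ m) ⟨a, ha.le⟩ * σm (Ideal.Quotient.mk (𝓂[K] ^ m) ⟨a, ha.le⟩)) +
      Ideal.Quotient.mk (𝓂[K] ^ m) ⟨x, hx⟩ + Ideal.Quotient.mk (𝓂[K] ^ m) ⟨c, hc⟩ =
        Ideal.Quotient.mk (𝓂[K] ^ m) zO := by
    rw [hinv, hzO, map_add, map_add, map_mul]
  have hcoe : ((zO * ((σ.comp 𝒪[K].subtype).codRestrict 𝒪[K] hσO) zO - ⟨t, ht⟩ : 𝒪[K]) : K) =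
      (κ * (a * σ a)⁻¹ + x + c) * σ (κ * (a * σ a)⁻¹ + x + c) - t := by
    rw [← hzcoe]; rfl
  rw [hZ, hσm, Ideal.quotientMap_mk, ← map_mul, Ideal.Quotient.factor_mk, Ideal.Quotient.eq, mem_maximalIdeal_pow_iff_v_le hd.vϖ, hcoe]

/-! ## §2 The coset count over the `X`-currency criterion (any `ℓ`) -/

section Count

variable [IsDiscreteValuationRing 𝒪[K]] [Finite (ResidueField 𝒪[K])] [IsAdicComplete (maximalIdeal 𝒪[K]) 𝒪[K]]

/-- **PROP. 13 NEAR ROW (cases (c)∕(e) and the equidistant `ℓ = 0` row) AS A COSET COUNT over the `X`-CURRENCY criterion — every residue characteristic.**  Let `τ ∈ U` and suppose that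
for every `p = p(u,x,w) ∈ P_H` **`p⁻¹ τ p ∈ H^K_m ↔ |N(κ·(uσu)⁻¹ + x + ξ₀) − ϖ^{2ℓ}γ| ≤ |ϖ^j|`** (binder `hce` — the (C3b) normal form `X = κν⁻¹ + w + r` with `w = x + z`, `ξ₀ = z + r`;
letters: `|κ| = 1`, `|κ + σκ| = 1`, `r` σ-fixed integral, `s` a UNIT, `ξ₀ + σξ₀ = r + r + s`, target `r(s + r) = ϖ^{2ℓ}γ`, `γ` a σ-fixed unit, `2ℓ < j ≤ m`; NO `1 ≤ ℓ`).  Then, `F` denoting the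
common size of the fibres of `ρ_m` on the coset space (`hfib`), `#{y ∈ P_H ⧸ (P_H ∩ H^K_m) : y⁻¹ τ y ∈ H^K_m} = F · (q^{m−1}(q+1)) · (q^{(m−ℓ)−(j−2ℓ)} · q^{m−ℓ−1}(q+1))` — ★'s RHS
VERBATIM.  Route = ★ `natCard_cosets_of_iff_norm_sub_le`'s with Step D = ★ p852093 `natCard_pairs_norm_congr_traceX` (claim (R0)). [cite: Flicker1998UnitaryFL, Prop. 13 p. 93; Prop. 8 p. 84] -/
theorem natCard_cosets_of_iff_norm_sub_le_xshape (hJ : J = (StdForm.antidiagonal 3).over K) (hd : UnramifiedLocalConjDatum σ ϖ) (h2 : (2 : K) ≠ 0)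
    (hσO : ∀ y : 𝒪[K], (σ.comp 𝒪[K].subtype) y ∈ 𝒪[K]) {m j ℓ : ℕ} (hm : 1 ≤ m) (hj : 2 * ℓ < j) (hjm : j ≤ m)
    {c um τ : ↥(unitaryGroupOfForm σ J)} (hc : ((c : GL (Fin 3) K) : Matrix (Fin 3) (Fin 3) K) = !![1, 0, 0; 0, -1, 0; 0, 0, 1])
    {κ r s ξ₀ γ : K} (hκ : Valued.v κ = 1) (htr : Valued.v (κ + σ κ) = 1) (hr : Valued.v r ≤ 1) (hσr : σ r = r) (hs : Valued.v s = 1)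
    (hξv : Valued.v ξ₀ ≤ 1) (hξ : ξ₀ + σ ξ₀ = r + r + s) (hγ : Valued.v γ = 1) (hσγ : σ γ = γ) (hC : r * (s + r) = ϖ ^ (2 * ℓ) * γ)
    (hce : ∀ p ∈ flickerPH σ J c, ∀ u x w : K,
      ((p : GL (Fin 3) K) : Matrix (Fin 3) (Fin 3) K) = !![u, 0, u * x; 0, w, 0; 0, 0, (σ u)⁻¹] →
        (p⁻¹ * τ * p ∈ flickerHK σ J c um ↔
          Valued.v ((κ * (u * σ u)⁻¹ + x + ξ₀) * σ (κ * (u * σ u)⁻¹ + x + ξ₀) - ϖ ^ (2 * ℓ) * γ) ≤ Valued.v (ϖ ^ j)))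
    {q : ℕ} (hq : Nat.card (ResidueField 𝒪[K]) = q ^ 2)
    {a₀ : 𝒪[K]} (ha₀ : IsUnit (((σ.comp 𝒪[K].subtype).codRestrict 𝒪[K] hσO) a₀ - a₀))
    (hSN : flickerPH σ J c ⊓ flickerHK σ J c um ≤ flickerPH0 σ J c (ϖ ^ m))
    [Finite (↥(flickerPH σ J c) ⧸ (flickerHK σ J c um).subgroupOf (flickerPH σ J c))] {F : ℕ}
    (hfib : ∀ z ∈ Set.range (fun w : ↥(flickerPH σ J c) ⧸ (flickerHK σ J c um).subgroupOf (flickerPH σ J c) =>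
        flickerPHRho σ m ((Quotient.out w : ↥(flickerPH σ J c)) : ↥(unitaryGroupOfForm σ J))),
      Nat.card {w : ↥(flickerPH σ J c) ⧸ (flickerHK σ J c um).subgroupOf (flickerPH σ J c) //
        flickerPHRho σ m ((Quotient.out w : ↥(flickerPH σ J c)) : ↥(unitaryGroupOfForm σ J)) = z} = F) :
    Nat.card {w : ↥(flickerPH σ J c) ⧸ (flickerHK σ J c um).subgroupOf (flickerPH σ J c) //
      ((Quotient.out w : ↥(flickerPH σ J c)) : ↥(unitaryGroupOfForm σ J))⁻¹ * τ * (Quotient.out w : ↥(flickerPH σ J c)) ∈ flickerHK σ J c um} =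
      F * ((q ^ (m - 1) * (q + 1)) * (q ^ ((m - ℓ) - (j - 2 * ℓ)) * (q ^ ((m - ℓ) - 1) * (q + 1)))) := by
  classical
  -- the restricted involution and the data in `𝒪[K]`
  set σO : 𝒪[K] →+* 𝒪[K] := (σ.comp 𝒪[K].subtype).codRestrict 𝒪[K] hσO with hσOdef
  have hσOσO : ∀ z, σO (σO z) = z := fun z => Subtype.ext (hd.σσ (z : K))
  have hunitO : ∀ {t : K} (ht : Valued.v t = 1), IsUnit (⟨t, ht.le⟩ : 𝒪[K]) := fun ht =>
    (Valuation.Integers.isUnit_iff_valuation_eq_one (Valuation.integer.integers _)).2 ht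
  have hϖle : Valued.v ϖ ≤ 1 := by rw [hd.vϖ, ← WithZero.exp_zero]; exact WithZero.exp_le_exp.2 (by norm_num)
  set pO : 𝒪[K] := ⟨ϖ, hϖle⟩ with hpO
  have hp : Irreducible pO := (IsDiscreteValuationRing.irreducible_iff_uniformizer pO).2 (maximalIdeal_integer_eq_span hd.vϖ)
  have hσp : σO pO = pO := Subtype.ext (by show σ ϖ = ϖ; exact hd.σϖ)
  set κO : 𝒪[K] := ⟨κ, hκ.le⟩ with hκO
  have hκtrO : IsUnit (κO + σO κO) := (Valuation.Integers.isUnit_iff_valuation_eq_one (Valuation.integer.integers _)).2 htr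
  set rO : 𝒪[K] := ⟨r, hr⟩ with hrO
  have hσrO : σO rO = rO := Subtype.ext (by show σ r = r; exact hσr)
  set sO : 𝒪[K] := ⟨s, hs.le⟩ with hsO
  have hsOu : IsUnit sO := hunitO hs
  set ξO : 𝒪[K] := ⟨ξ₀, hξv⟩ with hξO
  have hξO' : ξO + σO ξO = rO + rO + sO := Subtype.ext (by show ξ₀ + σ ξ₀ = r + r + s; exact hξ)
  set γO : 𝒪[K] := ⟨γ, hγ.le⟩ with hγO
  have hγOu : IsUnit γO := hunitO hγ
  have hσγO : σO γO = γO := Subtype.ext (by show σ γ = γ; exact hσγ)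
  have hCO : rO * (sO + rO) = pO ^ (2 * ℓ) * γO := Subtype.ext (by simpa [hrO, hsO, hpO, hγO] using hC)
  have hcv : Valued.v (ϖ ^ (2 * ℓ) * γ) ≤ 1 := by
    rw [map_mul, map_pow, hγ, mul_one]; exact pow_le_one₀ zero_le hϖle
  have hcO : (⟨ϖ ^ (2 * ℓ) * γ, hcv⟩ : 𝒪[K]) = pO ^ (2 * ℓ) * γO := Subtype.ext (by simp [hpO, hγO])
  -- the reduction maps
  set A := 𝒪[K] ⧸ 𝓂[K] ^ m with hA
  set σm := Ideal.quotientMap (maximalIdeal 𝒪[K] ^ m) σO (maximalIdeal_pow_le_comap σO hσOσO m) with hσm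
  have hσbar : σm = Ideal.quotientMap (𝓂[K] ^ m) ((σ.comp 𝒪[K].subtype).codRestrict 𝒪[K] hσO) (maximalIdeal_pow_le_comap_codRestrict σ hd.vϖ hd.vσ hσO m) := rfl
  -- the predicate counted, and the map `f = ρ_m ∘ out`
  set P := flickerPH σ J c with hPdef
  set S := (flickerHK σ J c um).subgroupOf (flickerPH σ J c) with hSdef
  set f : ↥P ⧸ S → A × A := fun w => flickerPHRho σ m ((Quotient.out w : ↥P) : ↥(unitaryGroupOfForm σ J)) with hfdef
  set Q : A × A → Prop := fun ux => IsUnit ux.1 ∧ σm ux.2 = -ux.2 ∧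
    Ideal.Quotient.factor (Ideal.pow_le_pow_right hjm)
        ((Ideal.Quotient.mk (maximalIdeal 𝒪[K] ^ m) κO * Ring.inverse (ux.1 * σm ux.1) + ux.2 + Ideal.Quotient.mk (maximalIdeal 𝒪[K] ^ m) ξO) *
          σm (Ideal.Quotient.mk (maximalIdeal 𝒪[K] ^ m) κO * Ring.inverse (ux.1 * σm ux.1) + ux.2 + Ideal.Quotient.mk (maximalIdeal 𝒪[K] ^ m) ξO)) =
      Ideal.Quotient.mk (maximalIdeal 𝒪[K] ^ j) (pO ^ (2 * ℓ) * γO) with hQdef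
  -- Step A: «good» ⟺ `Q ∘ f`
  have stepA : ∀ w : ↥P ⧸ S, ((Quotient.out w : ↥P) : ↥(unitaryGroupOfForm σ J))⁻¹ * τ * (Quotient.out w : ↥P) ∈ flickerHK σ J c um ↔ Q (f w) := by
    intro w
    set pp : ↥(unitaryGroupOfForm σ J) := ((Quotient.out w : ↥P) : ↥(unitaryGroupOfForm σ J)) with hpp
    have hpP : pp ∈ flickerPH σ J c := (Quotient.out w).2
    obtain ⟨u, x, wc, hpm, hvu, hvx, hσx, hvw, hσw⟩ := exists_coe_eq_borel_of_mem_flickerPH' σ hJ hd.σσ hd.vσ h2 hc hpP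
    have hu0 : u ≠ 0 := fun h => by rw [h, map_zero] at hvu; exact zero_ne_one hvu
    have hw0 : wc ≠ 0 := fun h => by rw [h, map_zero] at hvw; exact zero_ne_one hvw
    have hva : Valued.v (u * wc⁻¹) = 1 := by rw [map_mul, map_inv₀, hvu, hvw, inv_one, one_mul]
    have hρ : f w = (Ideal.Quotient.mk (𝓂[K] ^ m) ⟨u * wc⁻¹, hva.le⟩, Ideal.Quotient.mk (𝓂[K] ^ m) ⟨x, hvx⟩) := by
      show flickerPHRho σ m pp = _
      rw [flickerPHRho_of_coe_eq σ m hpm hu0, toQuotPow_of_le m hva.le, toQuotPow_of_le m hvx]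
    have hQ1 : σm (f w).2 = -(f w).2 := by
      rw [hσbar]; exact quotientMap_flickerPHRho_snd_of_unram σ hJ hd h2 hσO hc m hpP
    have hQ2 : IsUnit (f w).1 := isUnit_flickerPHRho_fst_of_unram σ hJ hd h2 hc m hpP
    rw [hce pp hpP u x wc hpm]
    -- rewrite `uσu = N(u w⁻¹)` and pass to classes
    have hσwc : σ wc = wc⁻¹ := eq_inv_of_mul_eq_one_left hσw
    have hN : u * σ u = (u * wc⁻¹) * σ (u * wc⁻¹) := by
      rw [map_mul, map_inv₀, hσwc, inv_inv]; field_simp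
    rw [hN, v_norm_sub_le_iff_factor_eq_xshape σ hd hσO hjm hva hκ.le hvx hξv hcv, hcO]
    rw [hρ] at hQ1 hQ2
    rw [hQdef, hρ]
    simp only
    rw [← hσbar]
    exact ⟨fun h => ⟨hQ2, hQ1, h⟩, fun h => h.2.2⟩
  -- Step B: count through `f`
  rw [Nat.card_congr (Equiv.subtypeEquivRight stepA), natCard_subtype_comp_eq_mul f Q F hfib]
  congr 1
  -- Step C: the range condition is implied by `Q` (★ C2-A surjectivity + (H1) + `S ≤ N₀`)
  have stepC : ∀ z, Q z → z ∈ Set.range f := by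
    rintro ⟨α, β⟩ ⟨hα, hβ, -⟩
    obtain ⟨a, rfl⟩ := Ideal.Quotient.mk_surjective α
    obtain ⟨bb, rfl⟩ := Ideal.Quotient.mk_surjective β
    have hau : IsUnit a := isUnit_of_isUnit_mk_pow (R := 𝒪[K]) hm hα
    have hav : Valued.v (a : K) = 1 := (Valuation.Integers.isUnit_iff_valuation_eq_one (Valuation.integer.integers _)).1 hau
    rw [hσbar] at hβ
    obtain ⟨pp, hpp, hρ⟩ := exists_mem_flickerPH_flickerPHRho_eq_of_unram σ hJ hd h2 hσO hc m a bb hav hβ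
    refine ⟨QuotientGroup.mk ⟨pp, hpp⟩, ?_⟩
    obtain ⟨s, hs'⟩ := QuotientGroup.mk_out_eq_mul S (⟨pp, hpp⟩ : ↥P)
    show flickerPHRho σ m ((Quotient.out (QuotientGroup.mk (⟨pp, hpp⟩ : ↥P) : ↥P ⧸ S) : ↥P) : ↥(unitaryGroupOfForm σ J)) = _
    rw [hs', Subgroup.coe_mul, ← hρ]
    symm
    rw [flickerPHRho_eq_iff_of_unram σ hJ hd h2 hc m hpp (Subgroup.mul_mem _ hpp (s : ↥P).2), ← mul_assoc, inv_mul_cancel, one_mul]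
    exact hSN ⟨(s : ↥P).2, s.2⟩
  rw [Nat.card_congr (Equiv.subtypeEquivRight fun z => (and_iff_right_of_imp (stepC z) : z ∈ Set.range f ∧ Q z ↔ Q z))]
  -- Step D: the `X`-currency pair count at `R = 𝒪[K]` (claim (R0); any `ℓ`)
  exact natCard_pairs_norm_congr_traceX σO hσOσO ha₀ hq hp hσp hm hj hjm hκtrO hσrO hsOu hξO' hγOu hσγO hCO

end Count

end UnitaryGroup

end Literature.NumberTheory.Automorphic
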